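import Summits.CriticalPhenomena.CardyFormulaZ2.Theses.CardyUSTContinuation
import Summits.CriticalPhenomena.CardyFormulaZ2.Theorems.CardyUSTContinuationCruxesGiveTarget
import Summits.CriticalPhenomena.CardyFormulaZ2.Theorems.CardyUSTContinuationContinuumFamily
import Summits.CriticalPhenomena.CardyFormulaZ2.Theorems.CardyUSTContinuationSmallFugacityLimitContinuumChecks
import Literature.Analysis.Complex.BoundedAnalyticFamilyLimit
import Mathlib.Analysis.Analytic.Uniqueness
import Mathlib.Analysis.Normed.Module.Convex

/-!
# Line `tree_taylor` for the crux `Target` (stmt-CriticalPhenomena-6046, route CardyUSTContinuation)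

STRATEGIST'S ALTERNATIVE LINE (planner-cstrat-stmt-CriticalPhenomena-6046-s2). It does NOT replace the
lead's registered skeleton `Lines/birth.lean` (v8); it is published beside it.

`Target = SmallFugacityLimit ∧ UniformAnalyticExtension` (`Iff.rfl`). The live line takes
`UniformAnalyticExtension` (= stmt-6047) as one stub and needs, for the other conjunct, an
identification datum W′ on `(0, 1]` which — as five lead cycles found — is `SmallFugacityLimit`
(stmt-6048) itself. This line replaces W′ by TAYLOR-JET IDENTIFICATION AT THE FREE (TREE) POINT
`t = 0`, where everything is Kirchhoff / transfer-current computable: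

* `stub_treeDisc` (A0′): the jointly-wired self-dual FK crossing probability `u_R(·, δ)` extends
  analytically to a complex disc `|t| < r` around the tree point, with radius and sup bound UNIFORM
  in the mesh (a Lee–Yang statement at `t = 0`: the 2-forest-dominated partition function
  `Z^joint_δ(t)/t^{V+1}` has no complex zeros in `|t| < r`, and `|N/Z| ≤ M` there);
* `stub_treeJet` (JET): the right Taylor jet `a_k(δ)` of `u_R(·, δ)` at `t = 0⁺` converges, ORDER BY
  ORDER, to the right jet `A_k(η)` of the Miller–Werner function `U(·, η)` (order 1 is the proved
  item `KirchhoffExtremalLength`, stmt-11234; order 2 is `SecondOrderCoefficient`, stmt-11235);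
* `stub_uniformAnalyticExtension` = the sibling crux stmt-6047 verbatim (shared seat).

GLUE (proved here, no `sorry`): `smallFugacityLimit_of_tree : TreeDisc → TreeJet → SmallFugacityLimit`
— uniform analyticity in the disc + coefficientwise convergence ⇒ convergence of the functions on
`(0, r/2)` (Cauchy estimates + Tannery: `Literature.Analysis.Complex.tendsto_of_forall_tendsto_taylorCoeff`,
the Benfatto–Giuliani–Mastropietro thermodynamic-limit pattern), and the limit `∑ A_k(η) t^k` IS
`U(t, η)` on `(0, min(r/2,1))` by the identity theorem against the landed `continuumFamily_proof`
(stmt-6052: `U(·, η)` is holomorphic on a complex neighbourhood of `[0,1]`). Hence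
`Target_of : UniformAnalyticExtension → TreeDisc → TreeJet → Target` via the landed
`cruxesGiveTarget_proof` (stmt-14172).

Observation recorded for the tribunal: `UniformAnalyticExtension ∧ TreeDisc` is exactly
"`u_R(·,δ)` is analytic and uniformly bounded on a δ-uniform complex neighbourhood of the CLOSED
segment `[0,1]`" (A0 of the card) — the thesis of the route with the tree endpoint included.
-/

noncomputable section

namespace Summit.CriticalPhenomena.CardyFormulaZ2.Cruxes.Target.TreeTaylor

open Set Filter Topology Metric
open scoped Nat NNReal ENNReal
open Summit.CriticalPhenomena.CardyFormulaZ2.Theses.CardyUSTContinuation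
  (Target SmallFugacityLimit UniformAnalyticExtension)
open Summit.CriticalPhenomena.CardyFormulaZ2.Theorems (cruxesGiveTarget_proof continuumFamily_proof)
open Summit.CriticalPhenomena.CardyFormulaZ2.Theorems.SmallFugacityContinuum
  (Zmw Umw uJ smallFugacityLimit_iff_Umw)
open Literature.Probability.RandomPlanarGeometry
  (ConformalRectangle crossRatio)

/-! ## Registered stub signatures (the `∀ Z U uJ, (Z = …) → (U = …) → (uJ = …) → …` device keeps the
registered one-line signature free of `let`/`:=`; instantiate with `Zmw Umw uJ` and `rfl`s). -/

namespace Sig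

/-- A0′ — UNIFORM ANALYTIC DISC AT THE TREE POINT. For every conformal rectangle there are `r > 0`
and `M` such that for all small meshes `δ` the crossing probability `t ↦ u_R(t, δ)` is the restriction
to `(0, r)` of a function holomorphic on the complex disc `|z| < r` and bounded there by `M`. -/
def TreeDisc : Prop :=
  ∀ (uJ : ConformalRectangle → ℝ → ℝ → ℝ),
    (∀ (R : ConformalRectangle) (t δ : ℝ), uJ R t δ = if h : 0 < δ then
      (@Literature.Probability.LatticeModels.fkDomainMeasure R.carrier δ (t / (1 + t)) (t ^ 2)
        (R.arc 0 ∪ R.arc 2) (Literature.Probability.LatticeModels.meshDomain_finite R.isBounded h).fintype).real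
        (Literature.Probability.Percolation.discreteCrossing R.carrier δ (R.arc 0) (R.arc 2)) else 0) →
    ∀ R : ConformalRectangle, ∃ r > (0:ℝ), ∃ M : ℝ, ∀ᶠ δ in 𝓝[>] (0:ℝ), ∃ g : ℂ → ℂ,
      DifferentiableOn ℂ g (Metric.ball (0:ℂ) r) ∧ (∀ z ∈ Metric.ball (0:ℂ) r, ‖g z‖ ≤ M) ∧
        ∀ t ∈ Set.Ioo (0:ℝ) r, g t = uJ R t δ

/-- JET — COEFFICIENTWISE SCALING LIMITS AT THE TREE POINT. For every conformal rectangle there are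
lattice jets `a k δ` and continuum jets `A k η` such that: for all small `δ`, `a · δ` is the right
Taylor jet of `u_R(·, δ)` at `0⁺`; for `η ∈ (0,1)`, `A · η` is the right Taylor jet of the
Miller–Werner function `U(·, η)` at `0⁺`; and each `a k` has crossing limit `A k`
(`k = 1`: `KirchhoffExtremalLength`, stmt-11234, proved; `k = 2`: `SecondOrderCoefficient`). -/
def TreeJet : Prop :=
  ∀ (Z U : ℝ → ℝ → ℝ) (uJ : ConformalRectangle → ℝ → ℝ → ℝ),
    (∀ u x, Z u x = x ^ (u / 2) * (1 - x) ^ (1 - 3 * u / 2) * ₂F₁ u (1 - u) (2 * u) x) →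
    (∀ t η, U t η = t * Z (Real.arccos (-(t / 2)) / Real.pi) η /
      (Z (Real.arccos (-(t / 2)) / Real.pi) (1 - η) + t * Z (Real.arccos (-(t / 2)) / Real.pi) η)) →
    (∀ (R : ConformalRectangle) (t δ : ℝ), uJ R t δ = if h : 0 < δ then
      (@Literature.Probability.LatticeModels.fkDomainMeasure R.carrier δ (t / (1 + t)) (t ^ 2)
        (R.arc 0 ∪ R.arc 2) (Literature.Probability.LatticeModels.meshDomain_finite R.isBounded h).fintype).real
        (Literature.Probability.Percolation.discreteCrossing R.carrier δ (R.arc 0) (R.arc 2)) else 0) →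
    ∀ R : ConformalRectangle, ∃ a A : ℕ → ℝ → ℝ,
      (∀ᶠ δ in 𝓝[>] (0:ℝ), ∀ k : ℕ, Tendsto (fun t : ℝ =>
          (uJ R t δ - ∑ j ∈ Finset.range k, a j δ * t ^ j) / t ^ k) (𝓝[>] 0) (𝓝 (a k δ))) ∧
      (∀ η ∈ Set.Ioo (0:ℝ) 1, ∀ k : ℕ, Tendsto (fun t : ℝ =>
          (U t η - ∑ j ∈ Finset.range k, A j η * t ^ j) / t ^ k) (𝓝[>] 0) (𝓝 (A k η))) ∧
      ∀ k : ℕ, R.HasCrossingLimit (a k) (A k)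

end Sig

/-! ## The stubs -/

/-- STUB (shared with the live line and with crux stmt-CriticalPhenomena-6047): the uniform analytic
extension of `u_R(·, δ)` to complex neighbourhoods of `[t₁, 1]`, `t₁ > 0`. -/
theorem stub_uniformAnalyticExtension : UniformAnalyticExtension := by
  sorry

/-- STUB A0′: uniform analytic disc at the tree point (see `Sig.TreeDisc`). -/
theorem stub_treeDisc : Sig.TreeDisc := by
  sorry

/-- STUB JET: coefficientwise scaling limits at the tree point (see `Sig.TreeJet`). -/
theorem stub_treeJet : Sig.TreeJet := by
  sorry

/-! ## Right Taylor jets at `0⁺` of complex-valued functions of a real variable -/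

/-- `c` is the right Taylor jet of `F : ℝ → ℂ` at `0⁺`:
`(F t - ∑_{j<k} c_j t^j) / t^k → c_k` as `t → 0⁺`, for every `k`. -/
def IsRightJet (F : ℝ → ℂ) (c : ℕ → ℂ) : Prop :=
  ∀ k : ℕ, Tendsto (fun t : ℝ => (F t - ∑ j ∈ Finset.range k, c j * (t : ℂ) ^ j) / (t : ℂ) ^ k)
    (𝓝[>] 0) (𝓝 (c k))

/-- Right jets are unique (strong induction on the order; `𝓝[>] 0` is non-trivial). -/
theorem IsRightJet.unique {F : ℝ → ℂ} {c c' : ℕ → ℂ} (h : IsRightJet F c) (h' : IsRightJet F c') :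
    c = c' := by
  funext k
  induction k using Nat.strong_induction_on with
  | _ k ih =>
    have hfun : (fun t : ℝ => (F t - ∑ j ∈ Finset.range k, c j * (t : ℂ) ^ j) / (t : ℂ) ^ k) =
        fun t : ℝ => (F t - ∑ j ∈ Finset.range k, c' j * (t : ℂ) ^ j) / (t : ℂ) ^ k := by
      funext t
      rw [Finset.sum_congr rfl (fun j hj => by rw [ih j (Finset.mem_range.mp hj)])]
    have h1 := h k
    rw [hfun] at h1
    exact tendsto_nhds_unique h1 (h' k)

/-- Right jets only depend on the germ of the function at `0⁺`. -/
theorem IsRightJet.congr {F G : ℝ → ℂ} {c : ℕ → ℂ} (h : IsRightJet F c)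
    (hFG : ∀ᶠ t in 𝓝[>] (0:ℝ), F t = G t) : IsRightJet G c := by
  intro k
  refine Tendsto.congr' ?_ (h k)
  filter_upwards [hFG] with t ht
  rw [ht]

/-- A real right jet is a complex right jet of the coerced function. -/
theorem isRightJet_ofReal {f : ℝ → ℝ} {a : ℕ → ℝ}
    (h : ∀ k : ℕ, Tendsto (fun t : ℝ => (f t - ∑ j ∈ Finset.range k, a j * t ^ j) / t ^ k)
      (𝓝[>] 0) (𝓝 (a k))) :
    IsRightJet (fun t => (f t : ℂ)) (fun k => (a k : ℂ)) := by
  intro k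
  have h1 := (Complex.continuous_ofReal.tendsto _).comp (h k)
  refine Tendsto.congr' (Eventually.of_forall fun t => ?_) h1
  simp only [Function.comp_apply]
  push_cast
  rfl

/-- A convergent power series with geometrically bounded coefficients has that coefficient sequence
as its right jet: if `‖c n‖ ≤ K / R^n` and `F t = ∑ c n t^n` on `(0, ε)`, then `c` is the right jet
of `F`. (Tail estimate `‖∑_{n>k} c_n t^n‖ ≤ 2K t^{k+1}/R^{k+1}` for `t ≤ R/2`.) -/
theorem isRightJet_of_hasSum {F : ℝ → ℂ} {c : ℕ → ℂ} {K R ε : ℝ} (hR : 0 < R) (hε : 0 < ε)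
    (hK : ∀ n, ‖c n‖ ≤ K / R ^ n) (hF : ∀ t ∈ Ioo (0:ℝ) ε, HasSum (fun n => c n * (t : ℂ) ^ n) (F t)) :
    IsRightJet F c := by
  have hK0 : 0 ≤ K := by simpa using (norm_nonneg (c 0)).trans (hK 0)
  intro k
  set ε' : ℝ := min ε (R / 2) with hε'
  have hε'0 : 0 < ε' := lt_min hε (by positivity)
  -- the key pointwise estimate on (0, ε')
  have key : ∀ t ∈ Ioo (0:ℝ) ε',
      ‖(F t - ∑ j ∈ Finset.range k, c j * (t : ℂ) ^ j) / (t : ℂ) ^ k - c k‖ ≤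
        2 * K / R ^ (k + 1) * t := by
    intro t ht
    have ht0 : 0 < t := ht.1
    have htε : t < ε := lt_of_lt_of_le ht.2 (min_le_left _ _)
    have htR : t ≤ R / 2 := (lt_of_lt_of_le ht.2 (min_le_right _ _)).le
    have hs := hF t ⟨ht0, htε⟩
    -- tail after k+1 terms
    have htail := (hasSum_nat_add_iff' (k + 1)).mpr hs
    have hsplit : F t - ∑ j ∈ Finset.range k, c j * (t : ℂ) ^ j - c k * (t : ℂ) ^ k =
        F t - ∑ i ∈ Finset.range (k + 1), c i * (t : ℂ) ^ i := by
      rw [Finset.sum_range_succ]; ring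
    have htc : ((t : ℂ)) ^ k ≠ 0 := pow_ne_zero _ (by exact_mod_cast ht0.ne')
    have hquot : (F t - ∑ j ∈ Finset.range k, c j * (t : ℂ) ^ j) / (t : ℂ) ^ k - c k =
        (F t - ∑ i ∈ Finset.range (k + 1), c i * (t : ℂ) ^ i) / (t : ℂ) ^ k := by
      rw [← hsplit]
      field_simp
    rw [hquot, norm_div, norm_pow, Complex.norm_real, Real.norm_eq_abs, abs_of_pos ht0]
    -- bound the tail by a geometric series
    set q : ℝ := t / R with hq
    have hq0 : 0 ≤ q := div_nonneg ht0.le hR.le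
    have hq1 : q ≤ 1 / 2 := by
      rw [hq, div_le_iff₀ hR]; linarith
    have hq1' : q < 1 := by linarith
    have hgeom : HasSum (fun n : ℕ => K * q ^ (k + 1) * q ^ n) (K * q ^ (k + 1) * (1 - q)⁻¹) :=
      (hasSum_geometric_of_lt_one hq0 hq1').mul_left _
    have hbound : ∀ n : ℕ, ‖c (n + (k + 1)) * (t : ℂ) ^ (n + (k + 1))‖ ≤ K * q ^ (k + 1) * q ^ n := by
      intro n
      rw [norm_mul, norm_pow, Complex.norm_real, Real.norm_eq_abs, abs_of_pos ht0]
      have h1 := hK (n + (k + 1))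
      have hRne : R ≠ 0 := hR.ne'
      calc ‖c (n + (k + 1))‖ * t ^ (n + (k + 1))
          ≤ K / R ^ (n + (k + 1)) * t ^ (n + (k + 1)) :=
            mul_le_mul_of_nonneg_right h1 (pow_nonneg ht0.le _)
        _ = K * q ^ (k + 1) * q ^ n := by
            rw [hq, div_pow, div_pow]
            field_simp
            ring
    have hT : ‖F t - ∑ i ∈ Finset.range (k + 1), c i * (t : ℂ) ^ i‖ ≤ K * q ^ (k + 1) * (1 - q)⁻¹ :=
      HasSum.norm_le_of_bounded htail hgeom hbound
    have htk : 0 < t ^ k := pow_pos ht0 k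
    rw [div_le_iff₀ htk]
    have hinv : (1 - q)⁻¹ ≤ 2 := by
      rw [inv_le_comm₀ (by linarith) (by norm_num)]; linarith
    calc ‖F t - ∑ i ∈ Finset.range (k + 1), c i * (t : ℂ) ^ i‖
        ≤ K * q ^ (k + 1) * (1 - q)⁻¹ := hT
      _ ≤ K * q ^ (k + 1) * 2 :=
          mul_le_mul_of_nonneg_left hinv (by positivity)
      _ = 2 * K / R ^ (k + 1) * t * t ^ k := by
          have hRne : R ≠ 0 := hR.ne'
          rw [hq, div_pow]
          field_simp
          ring
  -- squeeze
  rw [tendsto_iff_norm_sub_tendsto_zero]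
  have hlin : Tendsto (fun t : ℝ => 2 * K / R ^ (k + 1) * t) (𝓝[>] (0:ℝ)) (𝓝 0) := by
    have : Tendsto (fun t : ℝ => 2 * K / R ^ (k + 1) * t) (𝓝 (0:ℝ)) (𝓝 (2 * K / R ^ (k + 1) * 0)) :=
      tendsto_const_nhds.mul tendsto_id
    rw [mul_zero] at this
    exact this.mono_left nhdsWithin_le_nhds
  refine squeeze_zero' (Eventually.of_forall fun t => norm_nonneg _) ?_ hlin
  filter_upwards [Ioo_mem_nhdsGT hε'0] with t ht using key t ht

/-- Taylor coefficients of a function holomorphic and bounded on a disc form its right jet along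
the positive real axis. -/
theorem isRightJet_taylorCoeff {g : ℂ → ℂ} {r M : ℝ} (hr : 0 < r)
    (hg : DifferentiableOn ℂ g (ball (0:ℂ) r)) (hM : ∀ z ∈ ball (0:ℂ) r, ‖g z‖ ≤ M) :
    IsRightJet (fun t => g t) (fun n => (n ! : ℂ)⁻¹ • iteratedDeriv n g 0) := by
  have hr2 : 0 < r / 2 := by positivity
  -- Cauchy estimates on the circle of radius r/2
  have hdc : DiffContOnCl ℂ g (ball (0:ℂ) (r / 2)) := by
    refine DifferentiableOn.diffContOnCl (hg.mono ?_)
    rw [closure_ball (0:ℂ) hr2.ne']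
    exact closedBall_subset_ball (by linarith)
  have hMs : ∀ z ∈ sphere (0:ℂ) (r / 2), ‖g z‖ ≤ M := fun z hz =>
    hM z (sphere_subset_closedBall.trans (closedBall_subset_ball (by linarith)) hz)
  have hcoef : ∀ n, ‖(n ! : ℂ)⁻¹ • iteratedDeriv n g 0‖ ≤ M / (r / 2) ^ n := fun n =>
    Literature.Analysis.Complex.norm_inv_factorial_smul_iteratedDeriv_le hr2 hdc hMs n
  refine isRightJet_of_hasSum hr2 hr hcoef fun t ht => ?_
  have htb : (t : ℂ) ∈ ball (0:ℂ) r := by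
    rw [mem_ball, dist_zero_right, Complex.norm_real, Real.norm_eq_abs, abs_of_pos ht.1]
    exact ht.2
  have h := Complex.hasSum_taylorSeries_on_ball hg htb
  simp only [sub_zero] at h
  have hfun : (fun n => ((n ! : ℂ)⁻¹ • iteratedDeriv n g 0) * (t : ℂ) ^ n) =
      fun n => (n ! : ℂ)⁻¹ • ((t : ℂ) ^ n • iteratedDeriv n g 0) := by
    funext n; simp only [smul_eq_mul]; ring
  rw [hfun]
  exact h

/-! ## The continuum side: the right jet of an analytic function sums back to it -/

/-- The complex segment `[0, 1] ⊂ ℂ` is convex. -/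
theorem convex_ofReal_image_Icc01 : Convex ℝ (((↑) : ℝ → ℂ) '' Set.Icc (0:ℝ) 1) := by
  rintro _ ⟨a, ha, rfl⟩ _ ⟨b, hb, rfl⟩ u v hu hv huv
  refine ⟨u * a + v * b, ?_, by push_cast; simp⟩
  have h := (convex_Icc (0:ℝ) 1) ha hb hu hv huv
  simpa [smul_eq_mul] using h

/-- IDENTIFICATION OF THE LIMIT. Let `U : ℝ → ℝ` agree on `[0,1]` with a function `Uc` holomorphic on
a complex neighbourhood of `[0,1]`, and let `A` be the right jet of `U` at `0⁺` with the geometric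
bound `|A n| ≤ C / r^n`. Then `∑ A n t^n = U t` for every `t ∈ [0, 1]` with `t < r` (power series of
`Uc` at `0` has coefficients `A` by uniqueness of jets; its radius is `≥ r`; identity theorem on the
convex set `ball 0 r ∩ thickening`). -/
theorem hasSum_jet_of_analytic {U : ℝ → ℝ} {A : ℕ → ℝ} {C r : ℝ} (hr : 0 < r)
    (hA : ∀ n, |A n| ≤ C / r ^ n)
    (hjet : ∀ k : ℕ, Tendsto (fun t : ℝ => (U t - ∑ j ∈ Finset.range k, A j * t ^ j) / t ^ k)
      (𝓝[>] 0) (𝓝 (A k)))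
    {ρ : ℝ} (hρ : 0 < ρ) {Uc : ℂ → ℂ}
    (hUc : DifferentiableOn ℂ Uc (Metric.thickening ρ (((↑) : ℝ → ℂ) '' Set.Icc (0:ℝ) 1)))
    (hUcU : ∀ t ∈ Set.Icc (0:ℝ) 1, Uc t = U t)
    {t : ℝ} (ht0 : 0 ≤ t) (ht1 : t ≤ 1) (htr : t < r) :
    HasSum (fun n => (t : ℂ) ^ n • (A n : ℂ)) (U t : ℂ) := by
  set T : Set ℂ := Metric.thickening ρ (((↑) : ℝ → ℂ) '' Set.Icc (0:ℝ) 1) with hT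
  have hTo : IsOpen T := isOpen_thickening
  have hTc : Convex ℝ T := convex_ofReal_image_Icc01.thickening ρ
  have hmemT : ∀ s ∈ Set.Icc (0:ℝ) 1, (s : ℂ) ∈ T := fun s hs =>
    self_subset_thickening hρ _ ⟨s, hs, rfl⟩
  have h0T : (0:ℂ) ∈ T := by simpa using hmemT 0 ⟨le_rfl, zero_le_one⟩
  -- power series of Uc at 0
  obtain ⟨p, ρ₁, hp⟩ : ∃ (p : FormalMultilinearSeries ℂ ℂ ℂ) (ρ₁ : ℝ≥0∞), HasFPowerSeriesOnBall Uc p 0 ρ₁ := by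
    obtain ⟨p, ρ₁, hp⟩ := hUc.analyticAt (hTo.mem_nhds h0T)
    exact ⟨p, ρ₁, hp⟩
  -- geometric bound on the coefficients of p near 0
  obtain ⟨ρ₂, hρ₂0, hρ₂⟩ := ENNReal.lt_iff_exists_nnreal_btwn.mp hp.r_pos
  have hρ₂0' : (0:ℝ) < ρ₂ := by exact_mod_cast hρ₂0
  obtain ⟨C₁, -, hC₁⟩ := p.norm_mul_pow_le_of_lt_radius (hρ₂.trans_le hp.r_le)
  have hcoef : ∀ n, ‖p.coeff n‖ ≤ C₁ / (ρ₂ : ℝ) ^ n := by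
    intro n
    rw [← FormalMultilinearSeries.norm_apply_eq_norm_coef, le_div_iff₀ (pow_pos hρ₂0' n)]
    exact hC₁ n
  -- p.coeff is the right jet of U (coerced)
  have hjet1 : IsRightJet (fun s => (U s : ℂ)) p.coeff := by
    refine isRightJet_of_hasSum hρ₂0' (lt_min hρ₂0' one_pos) hcoef fun s hs => ?_
    have hs1 : s ∈ Set.Icc (0:ℝ) 1 := ⟨hs.1.le, (lt_of_lt_of_le hs.2 (min_le_right _ _)).le⟩
    have hsb : (s : ℂ) ∈ Metric.eball (0:ℂ) ρ₁ := by
      refine lt_trans ?_ hρ₂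
      rw [edist_zero_right, enorm_eq_nnnorm]
      have : ‖(s : ℂ)‖₊ < ρ₂ := by
        rw [← NNReal.coe_lt_coe, coe_nnnorm, Complex.norm_real, Real.norm_eq_abs, abs_of_pos hs.1]
        exact lt_of_lt_of_le hs.2 (min_le_left _ _)
      exact_mod_cast this
    have h := hp.hasSum hsb
    rw [zero_add, hUcU s hs1] at h
    have hfun : (fun n => p.coeff n * (s : ℂ) ^ n) = fun n => p n (fun _ => (s : ℂ)) := by
      funext n; rw [FormalMultilinearSeries.apply_eq_pow_smul_coeff, smul_eq_mul, mul_comm]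
    rw [hfun]
    exact h
  have hjet2 : IsRightJet (fun s => (U s : ℂ)) (fun n => (A n : ℂ)) := isRightJet_ofReal hjet
  have hcoeffA : p.coeff = fun n => (A n : ℂ) := hjet1.unique hjet2
  -- radius of p is at least r
  lift r to ℝ≥0 using hr.le
  have hr' : (0:ℝ) < r := hr
  have hrad : (r : ℝ≥0∞) ≤ p.radius := by
    refine p.le_radius_of_bound C fun n => ?_
    rw [FormalMultilinearSeries.norm_apply_eq_norm_coef, hcoeffA]
    simp only [Complex.norm_real, Real.norm_eq_abs]
    have h := hA n
    rwa [le_div_iff₀ (pow_pos hr' n)] at h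
  have hrad0 : 0 < p.radius := lt_of_lt_of_le (by exact_mod_cast hr') hrad
  have hps := p.hasFPowerSeriesOnBall hrad0
  -- identity theorem on W = ball 0 r ∩ T
  set W : Set ℂ := ball (0:ℂ) r ∩ T with hW
  have hWpre : IsPreconnected W := ((convex_ball (0:ℂ) r).inter hTc).isPreconnected
  have h0W : (0:ℂ) ∈ W := ⟨mem_ball_self hr', h0T⟩
  have hballrad : ∀ z ∈ ball (0:ℂ) r, z ∈ Metric.eball (0:ℂ) p.radius := by
    intro z hz
    refine lt_of_lt_of_le ?_ hrad
    rw [edist_zero_right, enorm_eq_nnnorm]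
    rw [mem_ball, dist_zero_right] at hz
    have : ‖z‖₊ < r := by exact_mod_cast hz
    exact_mod_cast this
  have hA1 : AnalyticOnNhd ℂ Uc W := fun z hz => hUc.analyticAt (hTo.mem_nhds hz.2)
  have hA2 : AnalyticOnNhd ℂ p.sum W := fun z hz => hps.analyticAt_of_mem (hballrad z hz.1)
  have hev : Uc =ᶠ[𝓝 (0:ℂ)] p.sum := by
    filter_upwards [Metric.eball_mem_nhds (0:ℂ) hp.r_pos] with y hy
    have := hp.sum hy
    rwa [zero_add] at this
  have hEq : EqOn Uc p.sum W := hA1.eqOn_of_preconnected_of_eventuallyEq hA2 hWpre h0W hev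
  -- evaluate at t
  have htb : (t : ℂ) ∈ ball (0:ℂ) r := by
    rw [mem_ball, dist_zero_right, Complex.norm_real, Real.norm_eq_abs, abs_of_nonneg ht0]
    exact htr
  have htW : (t : ℂ) ∈ W := ⟨htb, hmemT t ⟨ht0, ht1⟩⟩
  have hsumt := hps.hasSum (hballrad _ htb)
  rw [zero_add, ← hEq htW, hUcU t ⟨ht0, ht1⟩] at hsumt
  have hfun : (fun n => (t : ℂ) ^ n • (A n : ℂ)) = fun n => p n (fun _ => (t : ℂ)) := by
    funext n; rw [FormalMultilinearSeries.apply_eq_pow_smul_coeff, hcoeffA]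
  rw [hfun]
  exact hsumt

/-! ## The glue: `TreeDisc → TreeJet → SmallFugacityLimit` -/

/-- MAIN GLUE. Uniform analytic disc at the tree point + coefficientwise convergence of the right
jets to those of the Miller–Werner function ⇒ `SmallFugacityLimit` with `t₀ = min (r/2) 1`. -/
theorem smallFugacityLimit_of_tree (hD : Sig.TreeDisc) (hJ : Sig.TreeJet) : SmallFugacityLimit := by
  classical
  rw [smallFugacityLimit_iff_Umw]
  intro R
  obtain ⟨r, hr, M, hdisc⟩ := hD uJ (fun _ _ _ => rfl) R
  obtain ⟨a, A, hjet, hcont, hlim⟩ :=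
    hJ Zmw Umw uJ (fun _ _ => rfl) (fun _ _ => rfl) (fun _ _ _ => rfl) R
  refine ⟨min (r / 2) 1, lt_min (by positivity) one_pos, ?_⟩
  intro t ht ψ x hψx
  have hη : crossRatio x ∈ Set.Ioo (0:ℝ) 1 :=
    Literature.Probability.RandomPlanarGeometry.ConformalRectangle.crossRatio_mem_Ioo_of_isUniformizing hψx
  set η : ℝ := crossRatio x with hηdef
  have ht0 : 0 < t := ht.1
  have htr2 : t < r / 2 := lt_of_lt_of_le ht.2 (min_le_left _ _)
  have ht1 : t ≤ 1 := (lt_of_lt_of_le ht.2 (min_le_right _ _)).le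
  -- the property defining a "good" mesh and the family F
  let P : ℝ → (ℂ → ℂ) → Prop := fun δ g =>
    DifferentiableOn ℂ g (ball (0:ℂ) r) ∧ (∀ z ∈ ball (0:ℂ) r, ‖g z‖ ≤ M) ∧
      ∀ s ∈ Set.Ioo (0:ℝ) r, g s = uJ R s δ
  set F : ℝ → ℂ → ℂ := fun δ => if h : ∃ g, P δ g then h.choose else 0 with hFdef
  have hFgood : ∀ δ, (h : ∃ g, P δ g) → P δ (F δ) := by
    intro δ h
    have hF : F δ = h.choose := by simp only [hFdef, dif_pos h]
    rw [hF]
    exact h.choose_spec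
  have hFbad : ∀ δ, (¬ ∃ g, P δ g) → F δ = 0 := by
    intro δ h
    simp only [hFdef, dif_neg h]
  have hr2 : 0 < r / 2 := by positivity
  have hclos : closure (ball (0:ℂ) (r / 2)) ⊆ ball (0:ℂ) r := by
    rw [closure_ball (0:ℂ) hr2.ne']
    exact closedBall_subset_ball (by linarith)
  have hd : ∀ δ, DiffContOnCl ℂ (F δ) (ball (0:ℂ) (r / 2)) := by
    intro δ
    by_cases h : ∃ g, P δ g
    · exact DifferentiableOn.diffContOnCl ((hFgood δ h).1.mono hclos)
    · rw [hFbad δ h]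
      exact diffContOnCl_const
  have hMF : ∀ δ, ∀ z ∈ sphere (0:ℂ) (r / 2), ‖F δ z‖ ≤ max M 0 := by
    intro δ z hz
    by_cases h : ∃ g, P δ g
    · have hzr : z ∈ ball (0:ℂ) r :=
        hclos (by rw [closure_ball (0:ℂ) hr2.ne']; exact sphere_subset_closedBall hz)
      exact ((hFgood δ h).2.1 z hzr).trans (le_max_left _ _)
    · rw [hFbad δ h]
      simp
  -- Taylor coefficients of F δ at 0 converge to A n η
  have hgoodev : ∀ᶠ δ in 𝓝[>] (0:ℝ), (∃ g, P δ g) ∧ ∀ k : ℕ, Tendsto (fun s : ℝ =>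
      (uJ R s δ - ∑ j ∈ Finset.range k, a j δ * s ^ j) / s ^ k) (𝓝[>] 0) (𝓝 (a k δ)) :=
    hdisc.and hjet
  have hcoefF : ∀ᶠ δ in 𝓝[>] (0:ℝ), ∀ n : ℕ,
      (n ! : ℂ)⁻¹ • iteratedDeriv n (F δ) 0 = (a n δ : ℂ) := by
    filter_upwards [hgoodev] with δ hδ
    have hP := hFgood δ hδ.1
    have hj1 : IsRightJet (fun s => F δ s) (fun n => (n ! : ℂ)⁻¹ • iteratedDeriv n (F δ) 0) :=
      isRightJet_taylorCoeff hr hP.1 hP.2.1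
    have hj2 : IsRightJet (fun s => (uJ R s δ : ℂ)) (fun n => (a n δ : ℂ)) := isRightJet_ofReal hδ.2
    have hj1' : IsRightJet (fun s => (uJ R s δ : ℂ)) (fun n => (n ! : ℂ)⁻¹ • iteratedDeriv n (F δ) 0) := by
      refine hj1.congr ?_
      filter_upwards [Ioo_mem_nhdsGT hr] with s hs using hP.2.2 s hs
    have := hj1'.unique hj2
    intro n
    exact congrFun this n
  have ha : ∀ n : ℕ, Tendsto (fun δ => (n ! : ℂ)⁻¹ • iteratedDeriv n (F δ) 0) (𝓝[>] (0:ℝ))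
      (𝓝 ((A n η : ℝ) : ℂ)) := by
    intro n
    have h1 : Tendsto (fun δ => (a n δ : ℂ)) (𝓝[>] (0:ℝ)) (𝓝 ((A n η : ℝ) : ℂ)) :=
      (Complex.continuous_ofReal.tendsto _).comp (hlim n ψ x hψx)
    refine Tendsto.congr' ?_ h1
    filter_upwards [hcoefF] with δ hδ using (hδ n).symm
  -- convergence of the family at z = t
  have htz : ‖(t : ℂ)‖ < r / 2 := by
    rw [Complex.norm_real, Real.norm_eq_abs, abs_of_pos ht0]; exact htr2
  have hconv := Literature.Analysis.Complex.tendsto_of_forall_tendsto_taylorCoeff hr2 hd hMF ha htz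
  -- identify the limit with U t η
  obtain ⟨ρ, hρ, Uc, hUc, hUcU⟩ := (continuumFamily_proof).2 η hη
  have hAbd : ∀ n, |A n η| ≤ max M 0 / (r / 2) ^ n := by
    intro n
    have hlimn : Tendsto (fun δ => |a n δ|) (𝓝[>] (0:ℝ)) (𝓝 |A n η|) :=
      (continuous_abs.tendsto _).comp (hlim n ψ x hψx)
    refine le_of_tendsto hlimn ?_
    filter_upwards [hcoefF, hgoodev] with δ hδ hδ'
    have hP := hFgood δ hδ'.1
    have hdc : DiffContOnCl ℂ (F δ) (ball (0:ℂ) (r / 2)) := hd δ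
    have h := Literature.Analysis.Complex.norm_inv_factorial_smul_iteratedDeriv_le hr2 hdc (hMF δ) n
    rw [hδ n, Complex.norm_real, Real.norm_eq_abs] at h
    exact h
  have hsumU : HasSum (fun n => (t : ℂ) ^ n • ((A n η : ℝ) : ℂ)) ((Umw t η : ℝ) : ℂ) :=
    hasSum_jet_of_analytic (U := fun s => Umw s η) (A := fun n => A n η) hr2 hAbd (hcont η hη)
      hρ hUc hUcU ht0.le ht1 htr2
  rw [hsumU.tsum_eq] at hconv
  -- hconv : Tendsto (fun δ => F δ t) (𝓝[>] 0) (𝓝 (Umw t η : ℂ)); replace F δ t by uJ R t δ eventually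
  have hFt : ∀ᶠ δ in 𝓝[>] (0:ℝ), F δ t = (uJ R t δ : ℂ) := by
    filter_upwards [hgoodev] with δ hδ
    exact (hFgood δ hδ.1).2.2 t ⟨ht0, by linarith⟩
  have hconv' : Tendsto (fun δ => (uJ R t δ : ℂ)) (𝓝[>] (0:ℝ)) (𝓝 ((Umw t η : ℝ) : ℂ)) :=
    Tendsto.congr' hFt hconv
  refine Tendsto.congr (f₁ := fun δ => ((uJ R t δ : ℝ) : ℂ).re) (fun δ => Complex.ofReal_re _) ?_
  have h2 := (Complex.continuous_re.tendsto ((Umw t η : ℝ) : ℂ)).comp hconv'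
  rw [Complex.ofReal_re] at h2
  exact h2

/-! ## Composition: the line concludes the crux `Target` by name -/

/-- `tree_taylor` concludes the crux: `UniformAnalyticExtension → TreeDisc → TreeJet → Target`
(via the landed `cruxesGiveTarget_proof`, stmt-CriticalPhenomena-14172). -/
theorem Target_of :
    UniformAnalyticExtension → Sig.TreeDisc → Sig.TreeJet →
      Summit.CriticalPhenomena.CardyFormulaZ2.Theses.CardyUSTContinuation.Target :=
  fun hA hD hJ => cruxesGiveTarget_proof (smallFugacityLimit_of_tree hD hJ) hA

/-- The line, assembled from its stubs. -/
theorem target_from_stubs : Summit.CriticalPhenomena.CardyFormulaZ2.Theses.CardyUSTContinuation.Target :=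
  Target_of stub_uniformAnalyticExtension stub_treeDisc stub_treeJet

end Summit.CriticalPhenomena.CardyFormulaZ2.Cruxes.Target.TreeTaylor

end
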